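import Summits.Langlands.Langlands.Theses.IrreducibilityBySelfDuality
import Literature.NumberTheory.Automorphic.PairLFunctionPolesRepDataBoundaryAssembly
import Literature.NumberTheory.Automorphic.PairLFunctionPolesRepDataSchur
import Literature.NumberTheory.Automorphic.PairLFunctionPolesRepDataBoundaryRankOne

/-!
# Route `IrreducibilityBySelfDuality`, input `PairLBoundaryJS` (item stmt-Langlands-13622)

`PairLBoundaryJS` is Arthur–Clozel, *Simple algebras, base change, and the advanced theory of the
trace formula*, Ann. of Math. Stud. 120 (1989), Ch. 3 §2 (2.2), p. 171 (after Jacquet–Shalika II,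
Prop. 3.6, non-vanishing by Shahidi) for cuspidal Borel–Jacquet data on `GL_n × GL_m`: off the set
`X` and for unitary Satake families, the partial Rankin–Selberg product
`L^S(s, α × β) = ∏'_{w ∉ S} (satakePairPolynomial (α w) (β w)).eval (q_w^{-s}))⁻¹` has a finite
non-zero limit at every `s₀` with `Re s₀ = 1` from `Re s > 1`.

The route decl is, word for word, the Literature named fact
`Literature.NumberTheory.Automorphic.JacquetShalika1981_partialPairL_boundary_repData`
(`PairLFunctionPolesRepData`) with `partialPairL S α β` unfolded to its defining `tprod` and
`SatakeFamily F` unfolded to `HeightOneSpectrum (𝓞 F) → Multiset ℂ`; the two are definitionally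
equal (`PairLBoundaryJS_iff_partialPairL_boundary_repData`, `Iff.rfl`).

Contents (no mathematics is added; this file is the formal link between the item and the tree's
reduction of the fact):

* `PairLBoundaryJS_iff_partialPairL_boundary_repData` — the item IS the named fact;
* `PairLBoundaryJS_of_partialPairL_boundary_repData` — CONDITIONAL closure of the item on the
  named fact (the item closes the day `JacquetShalika1981_partialPairL_boundary_repData` is
  discharged);
* `PairLBoundaryJS_of_moeglinWaldspurger` — the item from the four leaves the fact currently
  stands on in the tree (`JacquetShalika1981_partialPairL_boundary_repData_of_moeglinWaldspurger`
  of `PairLFunctionPolesRepDataBoundaryAssembly`): Mœglin–Waldspurger, Appendice, Corollaire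
  (i)(a), (i)(b), (ii) (`MoeglinWaldspurger1989_partialPairL_entire_of_rank_ne`,
  `…_entire_of_ne_conj`, `…_of_eq_conj`: continuation of `L^S(s, π ⊗ σ)`) and multiplicity one
  on `L²_cusp(GL_n)` (`multiplicity_one_gl`), each granted at all ranks, number fields and
  automorphic measures; continuity and non-vanishing on `Re s = 1`, realisation of Borel–Jacquet
  data in `L²`, the Harish-Chandra dictionary and semisimplicity of the cusp forms are theorems of
  the tree.
* `PairLBoundaryJS_of_moeglinWaldspurger_of_isOrtho` — the item from THREE leaves, without
  multiplicity one (`JacquetShalika1981_partialPairL_boundary_repData_of_moeglinWaldspurger_of_isOrtho`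
  of `PairLFunctionPolesRepDataSchur`): Corollaire (i)(a), Corollaire (ii), and the entire
  continuation of `L^S(s, π ⊗ σ)` for ORTHOGONAL pairs `π ⟂ σ̄` inside one `L²_cusp(GL_n)` (the shape
  in which the Rankin–Selberg method proves Corollaire (i)(b)); "`s₀ ∉ X`" is converted into
  orthogonality by Schur's lemma instead of into `P ≠ P'.conj` plus `multiplicity_one_gl`.
* `PairLBoundaryJS_one_one` — the item's statement in ranks `n = m = 1` (pairs of cuspidal Borel–Jacquet
  data on `GL_1(𝔸_F)`, i.e. Hecke characters of the idele classes, over every number field),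
  **unconditionally**: the Literature theorem `JacquetShalika1981_partialPairL_boundary_repData_one_one`
  (`PairLFunctionPolesRepDataBoundaryRankOne`: the rank-wise reduction of the fact fed with the rank-one
  theorems `…_at_one_of_ne_conj_one` — Hecke–Landau `L^S(1, ψ) ≠ 0` — and `…_boundary_of_ne_one_one` —
  `ζ_F^S(1 + it) ≠ 0`, `L^S(1 + it, ψ) ≠ 0` — and `multiplicity_one_gl_one`), by definitional unfolding.
  The route's crux `ReducibleForcesEssSelfDual` consumes the item at `(n, m) = (1, 1)` (now a theorem)
  and at `(3, 1)`, `s₀ = 1` (finiteness of `L^S(s, π × θ⁻¹)` at `1`; in tree: `godementJacquet` at `GL_3`).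
-/

noncomputable section

-- `Summit.Langlands.Langlands.…` (summit = sub-problem name, D-0017 layout) trips `dupNamespace` on
-- every declaration; the lakefile sets `weak.linter.dupNamespace = false` project-wide.
set_option linter.dupNamespace false

open scoped MatrixGroups Topology
open NumberField IsDedekindDomain MeasureTheory Filter
open Literature.NumberTheory.Automorphic AdelicGroupData

namespace Summit.Langlands.Langlands.Theorems

/-- **The item is the named fact.** `PairLBoundaryJS` (route `IrreducibilityBySelfDuality`) and
`JacquetShalika1981_partialPairL_boundary_repData` (Arthur–Clozel Ch. 3 §2 (2.2) for Borel–Jacquet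
data) are definitionally the same proposition: the route decl unfolds `partialPairL S α β` to
`fun s => ∏' v : {v // v ∉ S}, ((satakePairPolynomial (α v.1) (β v.1)).eval (q_v ^ (-s)))⁻¹` and
`SatakeFamily F` to `HeightOneSpectrum (𝓞 F) → Multiset ℂ`. -/
theorem PairLBoundaryJS_iff_partialPairL_boundary_repData :
    Summit.Langlands.Langlands.Theses.IrreducibilityBySelfDuality.PairLBoundaryJS ↔
      JacquetShalika1981_partialPairL_boundary_repData :=
  Iff.rfl

/-- **Conditional closure of `PairLBoundaryJS`.** Granted the named fact
`JacquetShalika1981_partialPairL_boundary_repData` (Arthur–Clozel Ch. 3 §2 (2.2) for cuspidal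
Borel–Jacquet data: off `X`, `L^S(s, π ⊗ σ)` has a finite non-zero limit at every point of
`Re s = 1` from `Re s > 1`), the route input `PairLBoundaryJS` holds — by definitional unfolding. -/
theorem PairLBoundaryJS_of_partialPairL_boundary_repData
    (hJS : JacquetShalika1981_partialPairL_boundary_repData) :
    Summit.Langlands.Langlands.Theses.IrreducibilityBySelfDuality.PairLBoundaryJS :=
  PairLBoundaryJS_iff_partialPairL_boundary_repData.mpr hJS

/-- **`PairLBoundaryJS` from the four leaves the fact stands on.** The route input follows from
the discharges of exactly four named facts of the tree, each granted at all ranks, number fields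
and automorphic measures: Mœglin–Waldspurger, Appendice, Corollaire (i)(a)
(`MoeglinWaldspurger1989_partialPairL_entire_of_rank_ne`: `n ≠ m` ⇒ `L^S(s, π ⊗ σ)` entire), (i)(b)
(`MoeglinWaldspurger1989_partialPairL_entire_of_ne_conj`: `π ≇ σ̃` ⇒ entire), (ii)
(`MoeglinWaldspurger1989_partialPairL_of_eq_conj`: `π ≅ σ̃` ⇒ `s (s - 1) L^S` entire) and
multiplicity one on `L²_cusp(GL_n)` (`multiplicity_one_gl`); the composition is the tree's
`JacquetShalika1981_partialPairL_boundary_repData_of_moeglinWaldspurger` (continuity from the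
continuation, non-vanishing on `Re s = 1` by de la Vallée Poussin–Landau positivity, passage to
Borel–Jacquet data through the `L²` realisation), transported along
`PairLBoundaryJS_iff_partialPairL_boundary_repData`. -/
theorem PairLBoundaryJS_of_moeglinWaldspurger
    (hA : ∀ {n m : ℕ} {K : Type} [Field K] [NumberField K]
      {μ : Measure (gl n K).automorphicQuotient} [(gl n K).IsAutomorphicMeasure μ]
      {μ' : Measure (gl m K).automorphicQuotient} [(gl m K).IsAutomorphicMeasure μ'],
      MoeglinWaldspurger1989_partialPairL_entire_of_rank_ne (n := n) (m := m) (K := K) (μ := μ)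
        (μ' := μ'))
    (hB : ∀ {n : ℕ} {K : Type} [Field K] [NumberField K] {μ : Measure (gl n K).automorphicQuotient}
      [(gl n K).IsAutomorphicMeasure μ],
      MoeglinWaldspurger1989_partialPairL_entire_of_ne_conj (n := n) (K := K) (μ := μ))
    (hC : ∀ {n : ℕ} {K : Type} [Field K] [NumberField K] {μ : Measure (gl n K).automorphicQuotient}
      [(gl n K).IsAutomorphicMeasure μ],
      MoeglinWaldspurger1989_partialPairL_of_eq_conj (n := n) (K := K) (μ := μ))
    (hm1 : ∀ (n : ℕ) (K : Type) [Field K] [NumberField K] (μ : Measure (gl n K).automorphicQuotient)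
      [(gl n K).IsAutomorphicMeasure μ], multiplicity_one_gl n K μ) :
    Summit.Langlands.Langlands.Theses.IrreducibilityBySelfDuality.PairLBoundaryJS :=
  PairLBoundaryJS_of_partialPairL_boundary_repData
    (JacquetShalika1981_partialPairL_boundary_repData_of_moeglinWaldspurger hA hB hC hm1)

/-- **`PairLBoundaryJS` from three leaves, without multiplicity one.** The route input follows from
the discharges of exactly three statements of the tree's `L²` model, each granted at all ranks,
number fields and automorphic measures: Mœglin–Waldspurger, Appendice, Corollaire (i)(a)
(`MoeglinWaldspurger1989_partialPairL_entire_of_rank_ne`: `n ≠ m` ⇒ `L^S(s, π ⊗ σ)` entire),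
Corollaire (ii) (`MoeglinWaldspurger1989_partialPairL_of_eq_conj`: `π ≅ σ̃` ⇒ `s (s - 1) L^S` entire),
and the entire continuation of `L^S(s, π ⊗ σ)` for cuspidal `π`, `σ` in one `L²_cusp(GL_n)` with
`π ⟂ σ̄` (hypothesis `hB` — Corollaire (i)(b) in the shape the Rankin–Selberg method proves it: the
residues of the global integrals at `s = 0, 1` are multiples of `⟨φ, φ̄'⟩ = 0`). Compared with
`PairLBoundaryJS_of_moeglinWaldspurger` the leaf `multiplicity_one_gl` is gone: the hypothesis
"`s₀ ∉ X`" (inequality of Hecke matrices at infinitely many places) is converted into orthogonality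
by Schur's lemma (`JacquetShalika1981_partialPairL_boundary_repData_of_moeglinWaldspurger_of_isOrtho`
of `PairLFunctionPolesRepDataSchur`), transported along
`PairLBoundaryJS_iff_partialPairL_boundary_repData`. None of the three leaves is discharged in the
tree (2026-08-16). -/
theorem PairLBoundaryJS_of_moeglinWaldspurger_of_isOrtho
    (hA : ∀ {n m : ℕ} {K : Type} [Field K] [NumberField K]
      {μ : Measure (gl n K).automorphicQuotient} [(gl n K).IsAutomorphicMeasure μ]
      {μ' : Measure (gl m K).automorphicQuotient} [(gl m K).IsAutomorphicMeasure μ'],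
      MoeglinWaldspurger1989_partialPairL_entire_of_rank_ne (n := n) (m := m) (K := K) (μ := μ)
        (μ' := μ'))
    (hC : ∀ {n : ℕ} {K : Type} [Field K] [NumberField K] {μ : Measure (gl n K).automorphicQuotient}
      [(gl n K).IsAutomorphicMeasure μ],
      MoeglinWaldspurger1989_partialPairL_of_eq_conj (n := n) (K := K) (μ := μ))
    (hB : ∀ {n : ℕ} {K : Type} [Field K] [NumberField K] {μ : Measure (gl n K).automorphicQuotient}
      [(gl n K).IsAutomorphicMeasure μ] (_hn : 0 < n) (P P' : CuspidalAutomorphicRepGL n K μ)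
      (_hor : P.1.toSubmodule ⟂ P'.conj.1.toSubmodule)
      {S : Set (HeightOneSpectrum (𝓞 K))} (_hS : S.Finite) {α β : SatakeFamily K}
      (_hα : IsSatakeFamilyOf P S α) (_hβ : IsSatakeFamilyOf P' S β),
      ∃ g : ℂ → ℂ, Differentiable ℂ g ∧ ∀ s : ℂ, 1 < s.re → g s = partialPairL S α β s) :
    Summit.Langlands.Langlands.Theses.IrreducibilityBySelfDuality.PairLBoundaryJS :=
  PairLBoundaryJS_of_partialPairL_boundary_repData
    (JacquetShalika1981_partialPairL_boundary_repData_of_moeglinWaldspurger_of_isOrtho hA hC hB)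

/-- **`PairLBoundaryJS` in ranks `(1, 1)`, unconditionally.** The statement of the item
`PairLBoundaryJS` with `n = m = 1` — for cuspidal automorphic representations `π`, `π'` of
`GL_1(𝔸_F)` in the Borel–Jacquet model (Hecke characters of the idele classes of the number field `F`,
arbitrary central character): off a finite `S₀`, for every finite `S ⊇ S₀`, all unitary Satake families
`α`, `β` of `π`, `π'` off `S` and every `s₀` with `Re s₀ = 1` outside `X` (NOT `q_w^{1-s₀} α_w = β_w⁻¹`
for almost all `w`), the partial product `∏_{w ∉ S} (1 - α_w β_w q_w^{-s})⁻¹ = L^S(s, χ_π χ_{π'})` has a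
finite NON-ZERO limit as `s → s₀`, `Re s > 1` — is a theorem: it is, by definitional unfolding of
`partialPairL` and `SatakeFamily`, the Literature theorem
`JacquetShalika1981_partialPairL_boundary_repData_one_one` (Arthur–Clozel Ch. 3 §2 (2.2) for
Borel–Jacquet data in ranks `(1, 1)`: `ζ_F^S(1 + it) ≠ 0`, Landau 1903; `L^S(1 + it, ψ) ≠ 0` for unitary
`ψ ≠ 1`, Hecke–Landau / Iwasawa (1964), Prop. 4.4; multiplicity one on `L²_cusp(GL_1)`). This is the
`(1, 1)` slice of the item (the slice its consumer `ReducibleForcesEssSelfDual` uses for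
`L^S(s, θ_j / θ₁)`); the item itself remains the full fact
`JacquetShalika1981_partialPairL_boundary_repData` (all ranks). -/
theorem PairLBoundaryJS_one_one (F : Type) [Field F] [NumberField F]
    (hF hF' : isCompact_glFiniteIntegralLevel 1 F)
    (π : CuspidalAutomorphicRepData 1 F hF) (π' : CuspidalAutomorphicRepData 1 F hF') :
    ∃ S₀ : Set (IsDedekindDomain.HeightOneSpectrum (NumberField.RingOfIntegers F)), S₀.Finite ∧
      ∀ {S : Set (IsDedekindDomain.HeightOneSpectrum (NumberField.RingOfIntegers F))}, S.Finite →
        S₀ ⊆ S → ∀ {α β : IsDedekindDomain.HeightOneSpectrum (NumberField.RingOfIntegers F) → Multiset ℂ},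
          (∀ w ∉ S, π.1.HasSatakeParamAt w (α w)) → (∀ w ∉ S, π'.1.HasSatakeParamAt w (β w)) →
          (∀ w ∉ S, ‖(α w).prod‖ = 1) → (∀ w ∉ S, ‖(β w).prod‖ = 1) → ∀ {s₀ : ℂ}, s₀.re = 1 →
          ¬ ((1 : ℕ) = 1 ∧ ∀ᶠ w in cofinite,
              (α w).map ((((w.residueCard : ℂ) ^ (1 - s₀))) * ·) = (β w).map (·⁻¹)) →
          ∃ c : ℂ, c ≠ 0 ∧ Tendsto (fun s : ℂ =>
            ∏' w : {w : IsDedekindDomain.HeightOneSpectrum (NumberField.RingOfIntegers F) // w ∉ S},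
              ((satakePairPolynomial (α w.1) (β w.1)).eval ((w.1.residueCard : ℂ) ^ (-s)))⁻¹)
            (𝓝[{s : ℂ | 1 < s.re}] s₀) (𝓝 c) :=
  JacquetShalika1981_partialPairL_boundary_repData_one_one hF hF' π π'

end Summit.Langlands.Langlands.Theorems

end
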